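import Summits.BirchSwinnertonDyer.Rank1Residual.GaloisImage.IrreducibleModThreeCentralInvolution
import Literature.NumberTheory.EllipticCurves.HeegnerPointsKolyvaginSquares
import HarnessLib

/-!
# `−1` is a SQUARE in `ρ̄_{E,3}(Γ_ℚ)` for EVERY `E/ℚ` with `E[3]` irreducible (cell `bsd-stepL`,
# seat `bsd-stepL-shim3b` g3; helper for the crux `ShimuraKolyvaginOrderBoundAtThreeSurj` = item
# stmt-BirchSwinnertonDyer-19899, the record item 19616 and the (T4″)@3 corner; consumed by the
# sequel `ClassRecordThreeShimuraKolyvaginImageOverK`)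

HONEST FRAMING (programme file §HONESTY, verbatim): «no tranche here proves BSD; ARM L moves the
LITERAL column of an r ≤ 1 census into the kernel-proved-modulo-named-print column; ARM P changes what
«named print» is worth. The residue (4.31 %) and every SUMMIT-BEARING rung (S0–S3) stay theorem-bound
and are staffed by the 22 routes, not by this programme.» THEOREMS ONLY (no definition, no named fact,
no `sorry`); nothing here is a BSD class theorem; no census label moves.

## Why this file exists

The tree's Kolyvagin machine over an imaginary quadratic `K` (McCallum 1991 §3 / Gross 1991 §9:
`HeegnerPointsKolyvaginPairing`, `…PrimaryPairingProofs`, `…PrimaryCebotarevProofs`,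
`…TorsionProofs`) consumes the image of `Γ_K` on `E[p]` through displayed inputs — an element
`z ∈ Γ_K` acting as `−1` (`hz`), simplicity, scalar commutant — and the leaf `E(K)[p] = 0`
(`Gross1991_torsionBy_eq_bot`), all derived today from `ρ̄_{E,p}` ONTO (`RatClosure.exists_smul_eq_of_sq`
⟹ `KolyvaginImage.*`: `ρ̄(Γ_K) ⊇ ρ̄(Γ_ℚ)² = GL₂(𝔽_p)²`). Seat g2 (`ClassRecordThreeShimuraKolyvaginMinusOneAllLevels`)
produced `−1 ∈ ρ_{E,3ⁿ}(Γ_ℚ)` from `E[3]` irreducible alone and left the passage `Γ_ℚ → Γ_K` open.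
Since `[Γ_ℚ : Γ_K] = 2` puts every SQUARE of `Γ_ℚ` inside `Γ_K`, that passage needs no ramification
theory once `−1` is known to be a square IN THE IMAGE; this file proves exactly that, uniformly in
the mod-`3` image:

* §1 (pure algebra) **`sq_eq_one_or_sq_eq_neg_of_pow_four`** — an additive automorphism `g` of an
  abelian group of order `9` killed by `3` with `g⁴ = 1` has `g² = 1` or `g² = −1` («the elements of
  order `4` of `GL₂(𝔽₃)` square to `−1»`, intrinsically: the anti-fixed group of `g²` would be a
  `g`-stable line `ℤR` with `gR = nR`, `n² ≡ −1 (mod 3)`); **`exists_smul_smul_ne_of_irreducible`** —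
  a group acting on such a `T` with no stable subgroup other than `⊥`, `⊤` has an element with
  `σ² ≠ 1` (an abelian group generated by involutions of `𝔽₃²` fixes a line).
* §2 **`exists_sq_smul_eq_neg_three_of_irr`** — `E[3]` irreducible ⟹ some `γ ∈ Γ_ℚ` has `γ²`
  acting as `−1` on `E[3]`. Onto: `γ ↦ J = (x, y) ↦ (−y, x)` (`KolyvaginImage.rotJ`). Not onto: the
  image is a `2`-group with `g⁸ = 1` (part 11c: order prime to `3`, Serre Prop. 15, and the
  `GL₂(𝔽₃)` exponent certificate `GL2F3Cyc`), some `g = ρ̄(σ)` has `g² ≠ 1` (§1), and §1 applied to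
  `g` or `g²` gives `γ = σ` or `σ²`.

The sequel turns this into `−1 ∈ ρ_{E,3^M}(Γ_K)` and `E(K)[3^∞] = 0` for EVERY quadratic `K`
(Matar–Nekovář 2019 Cor. 5.21 (e′) / Prop. 5.26 (2) and Cha 2005 Lemmas 22–23 print the
image-uniformity these encode; the tree's `Kolyvagin1990_…` / `MatarNekovar2019.thm03_…` facts carry
no `3`-adic clause). NOT claimed: `p ≥ 5` (an irreducible subgroup of `GL₂(𝔽_p)` of order prime to
`p` need not be a `2`-group); simplicity / scalar commutant over `K`; any class theorem of BSD type.

References: [Serre1972] J.-P. Serre, Invent. Math. 15 (1972) §2.4 Prop. 15, §2.5–2.6;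
[GrossLMS1991] B. H. Gross, LMS LN 153 (1991) §9 Prop. 9.1; [McCallumLMS1991] §3;
[MatarNekovar2019] Cor. 5.21 (e′), Prop. 5.26 (2); [Cha2005] Lemmas 22–23.
-/

set_option autoImplicit false

set_option linter.dupNamespace false -- the Theorems namespace repeats the summit name, as in every sibling

noncomputable section

open scoped Classical

open Field WeierstrassCurve
  Literature.NumberTheory.EllipticCurves Literature.NumberTheory.GaloisRepresentations
  Literature.NumberTheory.EllipticCurves.Rank1Residual
  Summit.BirchSwinnertonDyer.Rank1Residual.GaloisImage

namespace Summit.BirchSwinnertonDyer.BirchSwinnertonDyer.Theorems.ShimuraKolyvaginMinusOneSquare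

/-! ## §1. Pure algebra: automorphisms of order `4` of a group of order `9` square to `−1` -/

section GroupTheory

variable {T : Type*} [AddCommGroup T]

/-- **The elements of order `4` of `GL₂(𝔽₃)` square to `−1`, intrinsically.** Let `T` be an abelian
group of order `9` killed by `3` and `g` an additive automorphism of `T` with `g⁴ = 1`. Then `g² = 1`
or `g² = −1`. Proof: otherwise the anti-fixed subgroup `L = {t | g² t = −t}` of the involution `g²`
is proper (some `t` has `g² t ≠ −t`) and non-zero (`R = g² t₁ − t₁ ≠ 0` lies in it), hence of order
`3` and equal to `ℤR`; it is `g`-stable, so `gR = nR` and `−R = g² R = n² R`, i.e. `3 ∣ n² + 1`,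
impossible. [cite: Serre1972, §2.5 (the subgroups of GL₂(𝔽₃))] -/
theorem sq_eq_one_or_sq_eq_neg_of_pow_four (hT : ∀ t : T, (3 : ℕ) • t = 0) (hcard : Nat.card T = 9)
    (g : T ≃+ T) (h4 : ∀ t, g (g (g (g t))) = t) :
    (∀ t, g (g t) = t) ∨ (∀ t, g (g t) = -t) := by
  by_contra h
  rw [not_or, not_forall, not_forall] at h
  obtain ⟨⟨t₁, ht₁⟩, ⟨t₂, ht₂⟩⟩ := h
  haveI : Finite T := Nat.finite_of_card_ne_zero (by rw [hcard]; decide)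
  -- the anti-fixed subgroup of `g²`
  set k : T →+ T := (g : T →+ T).comp (g : T →+ T) with hk
  have hk_apply : ∀ t, k t = g (g t) := fun _ => rfl
  set L : AddSubgroup T := (k + AddMonoidHom.id T).ker with hL
  have hmemL : ∀ t, t ∈ L ↔ g (g t) = -t := fun t => by
    rw [hL, AddMonoidHom.mem_ker, AddMonoidHom.add_apply, AddMonoidHom.id_apply, hk_apply,
      add_eq_zero_iff_eq_neg]
  -- `R := g² t₁ − t₁ ∈ L`, `R ≠ 0`
  set R : T := g (g t₁) - t₁ with hR
  have hRL : R ∈ L := by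
    rw [hmemL, hR, map_sub, map_sub, h4, neg_sub]
  have hR0 : R ≠ 0 := fun h0 => ht₁ (sub_eq_zero.mp h0)
  have hR3 : addOrderOf R = 3 := addOrderOf_eq_prime (hT R) hR0
  -- `L` is proper: `t₂ ∉ L`
  have hLtop : L ≠ ⊤ := by
    intro htop
    have : t₂ ∈ L := htop ▸ AddSubgroup.mem_top t₂
    exact ht₂ ((hmemL t₂).mp this)
  -- `#L = 3`, so `L = ℤR`
  have hLcard : Nat.card L = 3 := by
    have hdvd : Nat.card L ∣ 3 ^ 2 := by
      rw [show (3 : ℕ) ^ 2 = 9 by norm_num, ← hcard]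
      exact AddSubgroup.card_addSubgroup_dvd_card L
    obtain ⟨i, hi, hLi⟩ := (Nat.dvd_prime_pow Nat.prime_three).mp hdvd
    have h3dvd : 3 ∣ Nat.card L := by
      rw [← hR3, ← Nat.card_zmultiples R]
      exact AddSubgroup.card_dvd_of_le (AddSubgroup.zmultiples_le.2 hRL)
    interval_cases i
    · rw [hLi, pow_zero] at h3dvd
      exact absurd h3dvd (by decide)
    · rw [hLi, pow_one]
    · exfalso
      apply hLtop
      apply AddSubgroup.eq_top_of_card_eq
      rw [hLi, hcard]
      norm_num
  have hLeq : AddSubgroup.zmultiples R = L := by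
    apply AddSubgroup.eq_of_le_of_card_ge (AddSubgroup.zmultiples_le.2 hRL)
    rw [hLcard, Nat.card_zmultiples, hR3]
  -- `gR ∈ L = ℤR`
  have hgRL : g R ∈ L := by
    rw [hmemL]
    have h1 : g (g R) = -R := (hmemL R).mp hRL
    have := congrArg g h1
    rwa [map_neg] at this
  rw [← hLeq, AddSubgroup.mem_zmultiples_iff] at hgRL
  obtain ⟨n, hn⟩ := hgRL
  -- `−R = g² R = n² R`, so `3 ∣ n² + 1`: impossible
  have hsq : (n * n + 1) • R = 0 := by
    have h1 : g (g R) = -R := (hmemL R).mp hRL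
    rw [← hn, map_zsmul, ← hn, smul_smul] at h1
    rw [add_zsmul, one_zsmul, h1, neg_add_cancel]
  have hdvd : (3 : ℤ) ∣ n * n + 1 := by
    have := addOrderOf_dvd_iff_zsmul_eq_zero.mpr hsq
    rw [hR3] at this
    exact_mod_cast this
  have hmod : ((n * n + 1 : ℤ) : ZMod 3) = 0 := (ZMod.intCast_zmod_eq_zero_iff_dvd _ 3).mpr hdvd
  have hne : ∀ x : ZMod 3, x * x + 1 ≠ 0 := by decide
  exact hne (n : ZMod 3) (by push_cast at hmod; exact hmod)

variable {G : Type*} [Group G] [DistribMulAction G T]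

/-- **An irreducible group of automorphisms of `𝔽₃²` is not of exponent `≤ 2`.** If a group `G` acts
on an abelian group `T` of order `9` killed by `3` with no stable subgroup other than `⊥` and `⊤`,
then some `σ ∈ G` has `σ² ≠ 1` on `T`. (If every `σ² = 1` the image is abelian; either it lies in
`{±1}`, and every line is stable, or it contains an involution `σ ≠ ±1`, whose fixed group
`{t | σt = t} ∋ t + σt ≠ 0` is a proper non-zero stable subgroup.) [cite: Serre1972, §2.5] -/
theorem exists_smul_smul_ne_of_irreducible (hT : ∀ t : T, (3 : ℕ) • t = 0) (hcard : Nat.card T = 9)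
    (hirr : ∀ H : AddSubgroup T, (∀ (σ : G) (t : T), t ∈ H → σ • t ∈ H) → H = ⊥ ∨ H = ⊤) :
    ∃ (σ : G) (t : T), σ • σ • t ≠ t := by
  by_contra hall
  push Not at hall
  -- hall : ∀ σ t, σ • σ • t = t; the action is then commutative
  have hcomm : ∀ (σ τ : G) (t : T), σ • τ • t = τ • σ • t := fun σ τ t => by
    have h2 : (σ * τ) • (σ * τ) • (τ • σ • t) = τ • σ • t := hall (σ * τ) _
    rw [mul_smul, mul_smul, hall τ (σ • t), hall σ t] at h2
    exact h2
  haveI : Finite T := Nat.finite_of_card_ne_zero (by rw [hcard]; decide)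
  -- a non-zero element
  obtain ⟨P₀, hP₀⟩ : ∃ P : T, P ≠ 0 := by
    have h1 : 1 < Nat.card T := by rw [hcard]; decide
    obtain ⟨x, y, hxy⟩ := Finite.one_lt_card_iff_nontrivial.mp h1
    by_cases hx : x = 0
    · exact ⟨y, fun hy => hxy (hx.trans hy.symm)⟩
    · exact ⟨x, hx⟩
  have hord : addOrderOf P₀ = 3 := addOrderOf_eq_prime (hT P₀) hP₀
  by_cases hsc : ∀ σ : G, (∀ t : T, σ • t = t) ∨ (∀ t : T, σ • t = -t)
  · -- every element is `±1`: the line `ℤP₀` is stable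
    have hstab : ∀ (σ : G) (t : T), t ∈ AddSubgroup.zmultiples P₀ →
        σ • t ∈ AddSubgroup.zmultiples P₀ := fun σ t ht => by
      rcases hsc σ with hs | hs
      · rw [hs t]; exact ht
      · rw [hs t]; exact neg_mem ht
    rcases hirr (AddSubgroup.zmultiples P₀) hstab with h | h
    · rw [AddSubgroup.zmultiples_eq_bot] at h
      exact hP₀ h
    · have hc : Nat.card (AddSubgroup.zmultiples P₀) = 9 := by
        rw [h, AddSubgroup.card_top, hcard]
      rw [Nat.card_zmultiples, hord] at hc
      exact absurd hc (by decide)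
  · -- an involution `σ ≠ ±1`: its fixed group is a proper non-zero stable subgroup
    rw [not_forall] at hsc
    obtain ⟨σ, hσ⟩ := hsc
    rw [not_or, not_forall, not_forall] at hσ
    obtain ⟨⟨t₁, ht₁⟩, ⟨t₂, ht₂⟩⟩ := hσ
    set F : AddSubgroup T :=
      { carrier := {t | σ • t = t}
        add_mem' := fun {a b} ha hb => by
          simp only [Set.mem_setOf_eq] at ha hb ⊢
          rw [smul_add, ha, hb]
        zero_mem' := by simp only [Set.mem_setOf_eq, smul_zero]
        neg_mem' := fun {a} ha => by
          simp only [Set.mem_setOf_eq] at ha ⊢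
          rw [smul_neg, ha] } with hF
    have hmemF : ∀ t, t ∈ F ↔ σ • t = t := fun t => Iff.rfl
    have hstab : ∀ (τ : G) (t : T), t ∈ F → τ • t ∈ F := fun τ t ht => by
      rw [hmemF] at ht ⊢
      rw [hcomm, ht]
    rcases hirr F hstab with h | h
    · -- `t₂ + σ t₂ ∈ F` is non-zero
      have hmem : t₂ + σ • t₂ ∈ F := by
        rw [hmemF, smul_add, hall, add_comm]
      rw [h, AddSubgroup.mem_bot, add_eq_zero_iff_neg_eq] at hmem
      exact ht₂ hmem.symm
    · have : t₁ ∈ F := h ▸ AddSubgroup.mem_top t₁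
      exact ht₁ ((hmemF t₁).mp this)

end GroupTheory

/-! ## §2. `E[3]` irreducible ⟹ `−1` is a square in `ρ̄_{E,3}(Γ_ℚ)` -/

section RatSide

variable (W : WeierstrassCurve ℚ) [W.IsElliptic]

/-- **`ρ̄_{E,3}` onto ⟹ some `γ ∈ Γ_ℚ` has `γ²` acting as `−1` on `E[3]`** (`γ ↦ J`,
`J = (x, y) ↦ (−y, x)`, `J² = −1`; frame `E[3] ≃ (ℤ/3)²` from `#E[3] = 9`).
[cite: GrossLMS1991, §9 (before Prop. 9.1)] -/
theorem exists_sq_smul_eq_neg_three_of_surj [Fact (Nat.Prime 3)] (hs : Surj W 3) :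
    ∃ γ : absoluteGaloisGroup ℚ, ∀ P : geomTorsion W ((3 : ℕ) : ℤ), γ • γ • P = -P := by
  have hE : Nat.card (geomTorsion W ((3 : ℕ) : ℤ)) = 3 ^ 2 :=
    Literature.NumberTheory.EllipticCurves.natCard_geomTorsion W 3
  obtain ⟨e⟩ := KolyvaginImage.nonempty_addEquiv_of_card_eq_sq (p := 3)
    (fun t => AddSubgroup.torsionBy.nsmul t) hE
  obtain ⟨γ, hγ⟩ := hs (Multiplicative.ofAdd (KolyvaginImage.transport e KolyvaginImage.rotJ))
  refine ⟨γ, fun P => ?_⟩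
  have hγ' : ∀ Q : geomTorsion W ((3 : ℕ) : ℤ),
      γ • Q = KolyvaginImage.transport e KolyvaginImage.rotJ Q := fun Q => by
    rw [← W.galoisRepTorsion_apply ((3 : ℕ) : ℤ) γ Q, hγ]
    rfl
  rw [hγ', hγ', KolyvaginImage.transport_apply, KolyvaginImage.transport_apply,
    AddEquiv.apply_symm_apply, KolyvaginImage.rotJ_rotJ, map_neg, AddEquiv.symm_apply_apply]

/-- **`E[3]` irreducible, `ρ̄_{E,3}` not onto ⟹ some `γ ∈ Γ_ℚ` has `γ²` acting as `−1` on `E[3]`.**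
The image `G` is a `2`-group with `g⁸ = 1` for all `g` (part 11c: order prime to `3`, Serre Prop. 15,
and the `GL₂(𝔽₃)` exponent certificate); by `exists_smul_smul_ne_of_irreducible` some `g = ρ̄(σ)`
has `g² ≠ 1`; then `g² = −1` (§1 on `g`, if `g⁴ = 1`) or `g⁴ = −1` (§1 on `g²`), i.e. `γ = σ` or
`γ = σ²`. [cite: Serre1972, §2.4 Prop. 15 and §2.5] -/
theorem exists_sq_smul_eq_neg_three_of_irr_of_not_surj [Fact (Nat.Prime 3)] (hirr : Irr W 3)
    (hns : ¬ Surj W 3) :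
    ∃ γ : absoluteGaloisGroup ℚ, ∀ P : geomTorsion W ((3 : ℕ) : ℤ), γ • γ • P = -P := by
  haveI : Fact (Nat.Prime 2) := ⟨Nat.prime_two⟩
  set ρ := galoisRepTorsion W ((3 : ℕ) : ℤ) with hρ
  have hE : Nat.card (geomTorsion W ((3 : ℕ) : ℤ)) = 9 :=
    (Literature.NumberTheory.EllipticCurves.natCard_geomTorsion W 3).trans (by norm_num)
  have h3T : ∀ t : geomTorsion W ((3 : ℕ) : ℤ), (3 : ℕ) • t = 0 :=
    fun t => AddSubgroup.torsionBy.nsmul t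
  -- some `σ` with `σ² ≠ 1` on `E[3]`
  obtain ⟨σ, t₀, hσ⟩ := exists_smul_smul_ne_of_irreducible (G := absoluteGaloisGroup ℚ) h3T hE
    (fun H hH => hirr H (fun σ P hP => hH σ P hP))
  -- the image has order prime to `3` and exponent dividing `8`
  set G : Subgroup (Multiplicative (AddAut (geomTorsion W ((3 : ℕ) : ℤ)))) := ρ.range with hG
  haveI : Finite (geomTorsion W ((3 : ℕ) : ℤ)) := Nat.finite_of_card_ne_zero (by rw [hE]; decide)
  haveI : Finite (AddAut (geomTorsion W ((3 : ℕ) : ℤ))) :=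
    Finite.of_injective (fun e : AddAut (geomTorsion W ((3 : ℕ) : ℤ)) =>
      (e : geomTorsion W ((3 : ℕ) : ℤ) → geomTorsion W ((3 : ℕ) : ℤ))) DFunLike.coe_injective
  haveI : Finite (Multiplicative (AddAut (geomTorsion W ((3 : ℕ) : ℤ)))) :=
    inferInstanceAs (Finite (AddAut (geomTorsion W ((3 : ℕ) : ℤ))))
  have h3 : ¬ 3 ∣ Nat.card G := by
    rw [hG, MonoidHom.range_eq_map]
    exact not_dvd_card_map_galoisRepTorsion_of_irr_of_not_surj W 3 hirr hns ⊤
  obtain ⟨-, Φ, -, -⟩ := exists_frame_galoisRepTorsion_rat W 3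
  -- `ρ σ ^ 8 = 1`
  have h8 : ρ σ ^ 8 = 1 := by
    rcases GL2F3Cyc.pow_eight_eq_one_or_pow_six_eq_one_of_injective Φ.toMonoidHom Φ.injective
        (ρ σ) with h | h
    · exact h
    · -- `(ρ σ)⁶ = 1`: `ord((ρ σ)²) ∣ 3` and `∣ #G`, so `(ρ σ)² = 1`, contradicting the choice of `σ`
      exfalso
      set g : G := ⟨ρ σ, ⟨σ, rfl⟩⟩ with hg
      have h6 : g ^ 6 = 1 := Subtype.ext (by rw [Subgroup.coe_pow, hg, h, Subgroup.coe_one])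
      have h23 : orderOf (g ^ 2) ∣ 3 := orderOf_dvd_of_pow_eq_one (by rw [← pow_mul]; exact h6)
      have hG2 : orderOf (g ^ 2) ∣ Nat.card G := orderOf_dvd_natCard _
      have h1 : orderOf (g ^ 2) = 1 := by
        rcases (Nat.dvd_prime Nat.prime_three).mp h23 with h1 | h1
        · exact h1
        · rw [h1] at hG2; exact absurd hG2 h3
      rw [orderOf_eq_one_iff] at h1
      have h2 : ρ (σ * σ) = 1 := by
        rw [map_mul, ← pow_two]
        have := congrArg Subtype.val h1
        rwa [Subgroup.coe_pow, Subgroup.coe_one] at this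
      apply hσ
      rw [← mul_smul]
      exact (galoisRepTorsion_eq_one_iff' W ((3 : ℕ) : ℤ) _).mp h2 t₀
  -- translate powers of `ρ σ` into iterated actions
  have hpow : ∀ (n : ℕ) (P : geomTorsion W ((3 : ℕ) : ℤ)), (ρ σ ^ n).toAdd P = (σ ^ n) • P :=
    fun n P => by rw [← map_pow, galoisRepTorsion_apply]
  set g : geomTorsion W ((3 : ℕ) : ℤ) ≃+ geomTorsion W ((3 : ℕ) : ℤ) := (ρ σ).toAdd with hgdef
  have hg1 : ∀ P, g P = σ • P := fun P => by rw [hgdef, galoisRepTorsion_apply]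
  have hg4 : ∀ P, g (g (g (g P))) = (σ ^ 4) • P := fun P => by
    rw [hg1, hg1, hg1, hg1, show (4 : ℕ) = 1 + 1 + 1 + 1 from rfl, pow_succ, pow_succ, pow_succ,
      pow_one, mul_smul, mul_smul, mul_smul]
  have hσ8 : ∀ P : geomTorsion W ((3 : ℕ) : ℤ), (σ ^ 8) • P = P := fun P => by
    rw [← hpow, h8]
    rfl
  by_cases h4 : ∀ P : geomTorsion W ((3 : ℕ) : ℤ), (σ ^ 4) • P = P
  · -- `g⁴ = 1`, `g² ≠ 1` ⟹ `g² = −1`: take `γ = σ`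
    rcases sq_eq_one_or_sq_eq_neg_of_pow_four h3T hE g (fun P => by rw [hg4, h4]) with h | h
    · exact absurd (by rw [← hg1, ← hg1]; exact h t₀) hσ
    · exact ⟨σ, fun P => by rw [← hg1, ← hg1]; exact h P⟩
  · -- `g⁴ ≠ 1`: apply §1 to `g²` (`(g²)⁴ = g⁸ = 1`), so `g⁴ = −1`: take `γ = σ²`
    rw [not_forall] at h4
    obtain ⟨P₁, hP₁⟩ := h4
    set g2 : geomTorsion W ((3 : ℕ) : ℤ) ≃+ geomTorsion W ((3 : ℕ) : ℤ) := g.trans g with hg2def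
    have hg2 : ∀ P, g2 P = (σ ^ 2) • P := fun P => by
      rw [hg2def, AddEquiv.trans_apply, hg1, hg1, pow_two, mul_smul]
    have hg2_4 : ∀ P, g2 (g2 (g2 (g2 P))) = P := fun P => by
      rw [hg2, hg2, hg2, hg2, ← mul_smul, ← mul_smul, ← mul_smul, ← pow_add, ← pow_add, ← pow_add]
      exact hσ8 P
    rcases sq_eq_one_or_sq_eq_neg_of_pow_four h3T hE g2 hg2_4 with h | h
    · exfalso
      apply hP₁
      rw [show (4 : ℕ) = 2 + 2 from rfl, pow_add, mul_smul, ← hg2, ← hg2]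
      exact h P₁
    · refine ⟨σ ^ 2, fun P => ?_⟩
      rw [← hg2, ← hg2]
      exact h P

/-- **`E[3]` irreducible ⟹ `−1` is a SQUARE in `ρ̄_{E,3}(Γ_ℚ)`**: some `γ ∈ Γ_ℚ` has `γ²` acting
as `−1` on `E[3]`, for EVERY elliptic curve over `ℚ` with irreducible mod-`3` representation
(onto: `exists_sq_smul_eq_neg_three_of_surj`; not onto: `…_of_irr_of_not_surj`). This refines part
11c's `exists_smul_eq_neg_three_of_irr` (`−1 ∈ ρ̄(Γ_ℚ)`) to what the passage to a quadratic field
needs. [cite: Serre1972, §2.4 Prop. 15 and §2.5] -/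
theorem exists_sq_smul_eq_neg_three_of_irr [Fact (Nat.Prime 3)] (hirr : Irr W 3) :
    ∃ γ : absoluteGaloisGroup ℚ, ∀ P : geomTorsion W ((3 : ℕ) : ℤ), γ • γ • P = -P := by
  by_cases hs : Surj W 3
  · exact exists_sq_smul_eq_neg_three_of_surj W hs
  · exact exists_sq_smul_eq_neg_three_of_irr_of_not_surj W hirr hs

end RatSide

end Summit.BirchSwinnertonDyer.BirchSwinnertonDyer.Theorems.ShimuraKolyvaginMinusOneSquare

end
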